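import Mathlib
import HarnessLib
import Literature.Analysis.ValidatedNumerics.UnivariateIntervalNewtonContraction

/-!
# The always convergent SECOND-ORDER univariate interval Newton method (Alefeld–Herzberger, Ch. 7
# §D "Higher order methods", iteration (15) with `p = 1`, Theorem 5 (16)–(18)): the interval Taylor
# step `x − (f(x) + ½F₂(Y − x)²)/f'(x)`, retention of the zero by Taylor's formula, nesting and the
# linear contraction `1 − m₁/m₂` inherited from the simplified Newton half-step, the QUADRATIC bound
# `d(X⁽ᵏ⁺¹⁾) ≤ |F₂/M|·d(X⁽ᵏ⁾)²`, convergence `X⁽ᵏ⁾ → ξ`; and zero retention for Krawczyk's variant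

* G. Alefeld, J. Herzberger, *Introduction to Interval Computations*, Academic Press (1983), Ch. 7
  §D: assumptions (1), (2), (14); iteration (15); Theorem 5 (16), (17), (18) and its proof
  (Taylor's formula; `d(X⁽ᵏ⁺¹'⁰⁾) ≤ (1 − m₁/m₂)d(X⁽ᵏ⁾)` "as in Theorem 1"; `γ₁ = |F₂/M|`); the
  case `p = 1` written out after the proof; Krawczyk's method [34, §9 Thm 3] as reported there.
  [cite: AlefeldHerzberger1983, Ch. 7 §D Thm 5]
* R. E. Moore, *Methods and Applications of Interval Analysis*, SIAM (1979), §5.2 (5.16) (the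
  first-order step `N(X) = m − f(m)/F'(X)`). [cite: Moore1979, §5.2 (5.16)]

## Motivation and first use

The tree's univariate interval Newton files type Moore's operator and test
(`UnivariateIntervalNewton.lean`), runs of the iteration (`…Iteration.lean`), Moore's rates
(`…Rates.lean`), Alefeld–Herzberger's contraction `γ = 1 − m₁/m₂` for arbitrary evaluation points and
their Theorem 4 (`…Contraction.lean`), the minimax optimality of the midpoint (`…OptimalPoint.lean`)
and Hansen's extended-division step (`UnivariateExtendedIntervalNewton.lean`).  All of these are
FIRST-ORDER: the derivative enters only through an enclosure `F'(X) ∋ f'`.  Alefeld–Herzberger's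
Ch. 7 §D (the principle is Ehrmann's) adds, after the simplified Newton half-step with a FIXED slope
enclosure `M`, a Taylor step that uses the POINT values `f(x⁽ᵏ⁾)`, `f'(x⁽ᵏ⁾)` and an enclosure `F₂`
of `f''`; the result is a method that is BOTH always (even monotonically, by nesting) convergent AND
of R-order `≥ 2` — Theorem 5.  This file types the case `p = 1` of (15) and of Theorem 5, which is
the one the book singles out (*"We now wish to investigate the case p = 1 in some further detail"*),
and the zero-retention statement the book reports for Krawczyk's second-order method.

## Dictionary (book ↔ this file)

* `X⁽ᵏ⁾ = [x₁⁽ᵏ⁾, x₂⁽ᵏ⁾]` ↔ `Icc (lo k) (hi k)`; the intermediate box `X⁽ᵏ⁺¹'⁰⁾` ↔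
  `Icc (lo' k) (hi' k)`; `x⁽ᵏ⁾ = m(X⁽ᵏ⁾) ∈ X⁽ᵏ⁾` (an ARBITRARY selection) ↔ `x k`.
* `M = [m₁, m₂] ∌ 0` ↔ `Icc m₁ m₂`; the book assumes WLOG `f` increasing (`0 < m₁`); here either sign
  is allowed (`0 ∉ M`) and `|F₂/M| = |F₂|/min(|m₁|, |m₂|)` with `|F₂| = max(|e₁|, |e₂|)`.
* `F₂ ∋ f''(x), x ∈ X⁽⁰⁾` (14) ↔ `Icc (e₁ k) (e₂ k) ∋ f''(t)` for `t ∈ X⁽ᵏ⁾` — a `k`-dependent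
  enclosure is allowed, which covers both the book's constant `F₂` and its parenthetical variant
  *"if the constant interval F₂ is replaced by f''(X⁽ᵏ⁾) in each step"*.
* the simplified Newton set `{x − f(x)/M}` ↔ `newtonSet x (f x) (Icc m₁ m₂)` (tree);
  the Taylor set `{x − (1/f'(x))(f(x) + ½F₂(Y − x)²)}` ↔ `taylorNewtonSet x (f x) (f' x) F₂ Y`
  (this file) := the RANGE `{x − (f(x) + ½e(y − x)²)/f'(x) : e ∈ F₂, y ∈ Y}`.  Since `e` and `y`
  each occur ONCE in the expression, exact interval evaluation of the book's formula yields exactly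
  (the hull of) this range, and any outward-rounded machine evaluation is a superset — zero
  retention transfers to supersets (`zero_mem_of_inter_taylorNewtonSet_subset`).

## Hypotheses — where this file is more explicit than the book

The book's (2) bounds the divided differences `f(x)/(x − ξ) ∈ M` at the zero `ξ` only, but its
iteration divides by `f'(x⁽ᵏ⁾)` and its proof of (18) uses `|F₂/f'(x⁽ᵏ⁾)| ≤ |F₂/M|`, i.e. tacitly
`f'(x⁽ᵏ⁾) ∈ M`.  We assume what is verified in practice (and what Theorem 4 of §C assumes):
`f'(t) ∈ M ∌ 0` for all `t ∈ X⁽⁰⁾`; (2) then follows from the mean value theorem and is not needed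
as a separate hypothesis.  Differentiability is taken as pointwise `HasDerivAt` data for `f` and
`f'` on the closed box (the book: `f` twice continuously differentiable); Taylor's formula with the
Lagrange remainder is derived from these data by Rolle's theorem (`exists_taylor_two_of_hasDerivAt`),
so no continuity of `f''` is required.  The existence of the zero `ξ ∈ X⁽⁰⁾` (the book's (1) plus
continuity) is a hypothesis `f ξ = 0` of the theorems, to be discharged by the user (sign change and
the intermediate value theorem, or `MemPhi.exists_zero` of `…OptimalPoint.lean`).

## What is NOT typed here

The general order `p ≥ 2` of (15) (sums of point derivatives `f⁽ᵛ⁾(x⁽ᵏ⁾)/ν!` up to `p` and the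
recursion `γᵢ₊₁ = γᵢ Σ … + 2|Fᵢ₊₂/M|/(i+2)!`); the R-order conclusion via Appendix A Thm 2; the
clause *"or the sequence comes to a rest at [ξ, ξ] after a finite number of steps"* (which concerns
machine arithmetic); rounded interval arithmetic; the optimality remark for `p = 2`; the
interpolatory methods of §E; convergence conditions for Krawczyk's variant (the book: *"Conditions
for convergence … are not given"*).
-/

namespace Literature.Analysis.ValidatedNumerics.IntervalNewton

open Set Filter Topology

/-! ### Taylor's formula of order two with Lagrange remainder from pointwise derivative data -/

section Taylor

variable {f f' f'' : ℝ → ℝ} {a b : ℝ}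

/-- **Taylor's formula used in the proof of Theorem 5** (order two, Lagrange remainder):
if `f` has derivative `f'` and `f'` has derivative `f''` at every point of `[a, b]`, then for
`x, y ∈ [a, b]` there is `η ∈ [a, b]` (between `x` and `y`) with
`f(y) = f(x) + f'(x)(y − x) + ½f''(η)(y − x)²`.  Proved from Rolle's theorem applied to
`t ↦ f(y) − f(t) − f'(t)(y − t) − ½K(y − t)²`; no continuity of `f''` is needed
[cite: AlefeldHerzberger1983, Ch. 7 §D Thm 5 (proof of (16), Taylor's formula)]. -/
theorem exists_taylor_two_of_hasDerivAt (hf : ∀ t ∈ Icc a b, HasDerivAt f (f' t) t)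
    (hf' : ∀ t ∈ Icc a b, HasDerivAt f' (f'' t) t) {x y : ℝ} (hx : x ∈ Icc a b)
    (hy : y ∈ Icc a b) :
    ∃ η ∈ Icc a b, f y = f x + f' x * (y - x) + f'' η * (y - x) ^ 2 / 2 := by
  rcases eq_or_ne y x with hyx | hyx
  · exact ⟨x, hx, by rw [hyx]; ring⟩
  have hyx2 : (y - x) ^ 2 ≠ 0 := pow_ne_zero 2 (sub_ne_zero.2 hyx)
  obtain ⟨K, hK⟩ : ∃ K : ℝ, K * (y - x) ^ 2 / 2 = f y - f x - f' x * (y - x) :=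
    ⟨2 * (f y - f x - f' x * (y - x)) / (y - x) ^ 2, by field_simp⟩
  -- the auxiliary function of the classical proof and its derivative
  have hG : ∀ t ∈ Icc a b, HasDerivAt
      (fun s => f y - f s - f' s * (y - s) - K * ((y - s) * (y - s)) / 2)
      ((y - t) * (K - f'' t)) t := by
    intro t ht
    have h3 : HasDerivAt (fun s : ℝ => y - s) (-1) t := (hasDerivAt_id' t).const_sub y
    have h := (((hasDerivAt_const t (f y)).fun_sub (hf t ht)).fun_sub
      ((hf' t ht).fun_mul h3)).fun_sub (((h3.fun_mul h3).const_mul K).div_const 2)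
    exact h.congr_deriv (by ring)
  have hGx : (fun s => f y - f s - f' s * (y - s) - K * ((y - s) * (y - s)) / 2) x = 0 := by
    show f y - f x - f' x * (y - x) - K * ((y - x) * (y - x)) / 2 = 0
    have e : K * ((y - x) * (y - x)) / 2 = K * (y - x) ^ 2 / 2 := by ring
    rw [e, hK]; ring
  have hGy : (fun s => f y - f s - f' s * (y - s) - K * ((y - s) * (y - s)) / 2) y = 0 := by
    show f y - f y - f' y * (y - y) - K * ((y - y) * (y - y)) / 2 = 0
    ring
  -- from a Rolle point `c ≠ y` with `(y − c)(K − f''(c)) = 0` we read off `K = f''(c)`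
  have key : ∀ c ∈ Icc a b, c ≠ y → (y - c) * (K - f'' c) = 0 →
      f y = f x + f' x * (y - x) + f'' c * (y - x) ^ 2 / 2 := by
    intro c _ hcy hc0
    have hyc : y - c ≠ 0 := sub_ne_zero.2 (Ne.symm hcy)
    rcases mul_eq_zero.1 hc0 with h1 | h2
    · exact absurd h1 hyc
    · have hKc : K = f'' c := by linarith
      rw [← hKc]; linarith [hK]
  rcases lt_or_gt_of_ne hyx with hlt | hgt
  · -- `y < x`: Rolle on `[y, x]`
    have hsub : Icc y x ⊆ Icc a b := Icc_subset_Icc hy.1 hx.2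
    obtain ⟨c, hc, hc0⟩ := exists_hasDerivAt_eq_zero hlt
      (fun t ht => (hG t (hsub ht)).continuousAt.continuousWithinAt) (hGy.trans hGx.symm)
      (fun t ht => hG t (hsub (Ioo_subset_Icc_self ht)))
    exact ⟨c, hsub (Ioo_subset_Icc_self hc),
      key c (hsub (Ioo_subset_Icc_self hc)) hc.1.ne' hc0⟩
  · -- `x < y`: Rolle on `[x, y]`
    have hsub : Icc x y ⊆ Icc a b := Icc_subset_Icc hx.1 hy.2
    obtain ⟨c, hc, hc0⟩ := exists_hasDerivAt_eq_zero hgt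
      (fun t ht => (hG t (hsub ht)).continuousAt.continuousWithinAt) (hGx.trans hGy.symm)
      (fun t ht => hG t (hsub (Ioo_subset_Icc_self ht)))
    exact ⟨c, hsub (Ioo_subset_Icc_self hc),
      key c (hsub (Ioo_subset_Icc_self hc)) hc.2.ne hc0⟩

end Taylor

/-! ### The interval Taylor step `x − (f(x) + ½F₂(Y − x)²)/f'(x)` as a set, and its soundness -/

section TaylorSet

/-- **The second-order step of (15) (`p = 1`, substep `i = 1`) as an exact range**:
`taylorNewtonSet x fx dfx E Y = {x − (fx + ½e(y − x)²)/dfx : e ∈ E, y ∈ Y}` — the book's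
`{x⁽ᵏ⁾ − (1/f'(x⁽ᵏ⁾))(f(x⁽ᵏ⁾) + ½F₂(X⁽ᵏ⁺¹'⁰⁾ − x⁽ᵏ⁾)²)}` with `fx = f(x⁽ᵏ⁾)`, `dfx = f'(x⁽ᵏ⁾)`,
`E = F₂`, `Y = X⁽ᵏ⁺¹'⁰⁾` (each variable occurs once, so exact interval evaluation gives its hull)
[cite: AlefeldHerzberger1983, Ch. 7 §D (15), Thm 5]. -/
def taylorNewtonSet (x fx dfx : ℝ) (E Y : Set ℝ) : Set ℝ :=
  (fun p : ℝ × ℝ => x - (fx + p.1 * (p.2 - x) ^ 2 / 2) / dfx) '' E ×ˢ Y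

variable {x fx dfx : ℝ} {E E' Y Y' : Set ℝ}

/-- Membership in the Taylor step set, unfolded [cite: AlefeldHerzberger1983, Ch. 7 §D (15)]. -/
theorem mem_taylorNewtonSet {z : ℝ} :
    z ∈ taylorNewtonSet x fx dfx E Y ↔
      ∃ e ∈ E, ∃ y ∈ Y, x - (fx + e * (y - x) ^ 2 / 2) / dfx = z := by
  constructor
  · rintro ⟨⟨e, y⟩, ⟨he, hy⟩, rfl⟩
    exact ⟨e, he, y, hy, rfl⟩
  · rintro ⟨e, he, y, hy, rfl⟩
    exact ⟨(e, y), ⟨he, hy⟩, rfl⟩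

/-- **Inclusion monotonicity** of the Taylor step in the enclosure `F₂` and in the box `Y` (the
"inclusion monotonicity" invoked in the proof of (16)) [cite: AlefeldHerzberger1983, Ch. 7 §D Thm 5 (proof of (16))]. -/
theorem taylorNewtonSet_mono (hE : E ⊆ E') (hY : Y ⊆ Y') :
    taylorNewtonSet x fx dfx E Y ⊆ taylorNewtonSet x fx dfx E' Y' :=
  image_mono (prod_mono hE hY)

/-- **The algebra of the soundness proof**: if `fx + dfx·(ξ − x) + ½e(ξ − x)² = 0` with `dfx ≠ 0`,
`e ∈ E`, `ξ ∈ Y`, then `ξ = x − (fx + ½e(ξ − x)²)/dfx ∈ taylorNewtonSet x fx dfx E Y`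
[cite: AlefeldHerzberger1983, Ch. 7 §D Thm 5 (proof of (16))]. -/
theorem mem_taylorNewtonSet_of_taylor_eq_zero {ξ e : ℝ} (hdfx : dfx ≠ 0) (he : e ∈ E)
    (hξ : ξ ∈ Y) (hT : fx + dfx * (ξ - x) + e * (ξ - x) ^ 2 / 2 = 0) :
    ξ ∈ taylorNewtonSet x fx dfx E Y := by
  refine mem_taylorNewtonSet.2 ⟨e, he, ξ, hξ, ?_⟩
  have h1 : (fx + e * (ξ - x) ^ 2 / 2) / dfx = -(ξ - x) := by
    rw [div_eq_iff hdfx]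
    linear_combination hT
  rw [h1]
  ring

/-- **(16), the Taylor substep: every zero `ξ ∈ Y ⊆ X` of `f` lies in the Taylor step set.**
`f`, `f'` differentiable on `X = [a, b]` with `f'' ∈ E` on `X`, `x ∈ X`, `f'(x) ≠ 0`: by Taylor's
formula `0 = f(ξ) = f(x) + f'(x)(ξ − x) + ½f''(η)(ξ − x)²`, hence
`ξ = x − (f(x) + ½f''(η)(ξ − x)²)/f'(x) ∈ x − (f(x) + ½E(Y − x)²)/f'(x)`
[cite: AlefeldHerzberger1983, Ch. 7 §D Thm 5 (16)]. -/
theorem zero_mem_taylorNewtonSet {f f' f'' : ℝ → ℝ} {a b : ℝ}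
    (hf : ∀ t ∈ Icc a b, HasDerivAt f (f' t) t) (hf' : ∀ t ∈ Icc a b, HasDerivAt f' (f'' t) t)
    (hE : ∀ t ∈ Icc a b, f'' t ∈ E) (hx : x ∈ Icc a b) (hdfx : f' x ≠ 0) (hY : Y ⊆ Icc a b)
    {ξ : ℝ} (hξ : ξ ∈ Y) (hfξ : f ξ = 0) :
    ξ ∈ taylorNewtonSet x (f x) (f' x) E Y := by
  obtain ⟨η, hη, hT⟩ := exists_taylor_two_of_hasDerivAt hf hf' hx (hY hξ)
  exact mem_taylorNewtonSet_of_taylor_eq_zero hdfx (hE η hη) hξ (by linarith)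

/-- **Zero retention through the intersected step and through OUTER enclosures**: with the data of
`zero_mem_taylorNewtonSet`, every zero `ξ ∈ Y` lies in `Y ∩ taylorNewtonSet …`, hence in any
superset `N'` of it (a machine evaluation of the book's formula, intersected with `Y`)
[cite: AlefeldHerzberger1983, Ch. 7 §D Thm 5 (16)]. -/
theorem zero_mem_of_inter_taylorNewtonSet_subset {f f' f'' : ℝ → ℝ} {a b : ℝ}
    (hf : ∀ t ∈ Icc a b, HasDerivAt f (f' t) t) (hf' : ∀ t ∈ Icc a b, HasDerivAt f' (f'' t) t)
    (hE : ∀ t ∈ Icc a b, f'' t ∈ E) (hx : x ∈ Icc a b) (hdfx : f' x ≠ 0) (hY : Y ⊆ Icc a b)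
    {N' : Set ℝ} (hN' : Y ∩ taylorNewtonSet x (f x) (f' x) E Y ⊆ N')
    {ξ : ℝ} (hξ : ξ ∈ Y) (hfξ : f ξ = 0) : ξ ∈ N' :=
  hN' ⟨hξ, zero_mem_taylorNewtonSet hf hf' hE hx hdfx hY hξ hfξ⟩

/-- **Deviation from the Newton point** (the width computation of (18), pointwise): for
`Y ⊆ X = [lo, hi] ∋ x`, `|f'(x)| ≥ μ > 0` and `F₂ = [e₁, e₂]`, every point `u` of the Taylor step
set satisfies `|u − (x − fx/f'(x))| ≤ ½(|F₂|/μ)·d(X)²`, `|F₂| = max(|e₁|, |e₂|)` — from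
`|e(y − x)²| ≤ |F₂|·d(X)²` (the book: `½d((F₂/f'(x))(X − X)²) ≤ |F₂/M|d(X)²`)
[cite: AlefeldHerzberger1983, Ch. 7 §D Thm 5 (proof of (18))]. -/
theorem abs_sub_newtonPoint_le_of_mem_taylorNewtonSet {lo hi e₁ e₂ μ u : ℝ}
    (hY : Y ⊆ Icc lo hi) (hx : x ∈ Icc lo hi) (hμ : 0 < μ) (hdfx : μ ≤ |dfx|)
    (hu : u ∈ taylorNewtonSet x fx dfx (Icc e₁ e₂) Y) :
    |u - (x - fx / dfx)| ≤ max |e₁| |e₂| / μ * (hi - lo) ^ 2 / 2 := by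
  obtain ⟨e, he, y, hy, rfl⟩ := mem_taylorNewtonSet.1 hu
  have hd0 : 0 < |dfx| := hμ.trans_le hdfx
  have h1 : x - (fx + e * (y - x) ^ 2 / 2) / dfx - (x - fx / dfx) =
      -(e * (y - x) ^ 2 / (2 * dfx)) := by ring
  rw [h1, abs_neg, abs_div, abs_mul, abs_mul, abs_two, abs_of_nonneg (sq_nonneg (y - x))]
  have hE : |e| ≤ max |e₁| |e₂| := abs_le_max_abs_abs he.1 he.2
  have hM : 0 ≤ max |e₁| |e₂| := (abs_nonneg _).trans hE
  have hy' := hY hy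
  have hsq : (y - x) ^ 2 ≤ (hi - lo) ^ 2 := by
    apply sq_le_sq' <;> linarith [hy'.1, hy'.2, hx.1, hx.2]
  calc |e| * (y - x) ^ 2 / (2 * |dfx|) ≤ max |e₁| |e₂| * (hi - lo) ^ 2 / (2 * |dfx|) :=
        div_le_div_of_nonneg_right (mul_le_mul hE hsq (sq_nonneg _) hM) (by positivity)
    _ ≤ max |e₁| |e₂| * (hi - lo) ^ 2 / (2 * μ) :=
        div_le_div_of_nonneg_left (by positivity) (by positivity) (by linarith)
    _ = max |e₁| |e₂| / μ * (hi - lo) ^ 2 / 2 := by ring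

/-- **(18) for one Taylor step: `d(Y ∩ N₂) ≤ d(N₂) ≤ |F₂/M|·d(X)²`.**  Any two points of the Taylor
step set over `Y ⊆ X = [lo, hi] ∋ x` with `|f'(x)| ≥ μ > 0`, `F₂ = [e₁, e₂]`, are within
`(max(|e₁|,|e₂|)/μ)·(hi − lo)²` of each other — the constant `γ₁ = |F₂/M|` of the book when
`μ = min(|m₁|, |m₂|)` [cite: AlefeldHerzberger1983, Ch. 7 §D Thm 5 (18)]. -/
theorem abs_sub_le_of_mem_taylorNewtonSet {lo hi e₁ e₂ μ u v : ℝ}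
    (hY : Y ⊆ Icc lo hi) (hx : x ∈ Icc lo hi) (hμ : 0 < μ) (hdfx : μ ≤ |dfx|)
    (hu : u ∈ taylorNewtonSet x fx dfx (Icc e₁ e₂) Y)
    (hv : v ∈ taylorNewtonSet x fx dfx (Icc e₁ e₂) Y) :
    |u - v| ≤ max |e₁| |e₂| / μ * (hi - lo) ^ 2 := by
  have h1 := abs_sub_newtonPoint_le_of_mem_taylorNewtonSet hY hx hμ hdfx hu
  have h2 := abs_sub_newtonPoint_le_of_mem_taylorNewtonSet hY hx hμ hdfx hv
  rw [abs_sub_comm] at h2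
  calc |u - v| ≤ |u - (x - fx / dfx)| + |x - fx / dfx - v| := abs_sub_le _ _ _
    _ ≤ max |e₁| |e₂| / μ * (hi - lo) ^ 2 := by linarith

/-- **(18) for boxes**: if `[a, b] ≠ ∅` is contained in the Taylor step set over `Y ⊆ [lo, hi] ∋ x`
(`|f'(x)| ≥ μ > 0`, `F₂ = [e₁, e₂]`), then `b − a ≤ (max(|e₁|,|e₂|)/μ)·(hi − lo)²`
[cite: AlefeldHerzberger1983, Ch. 7 §D Thm 5 (18)]. -/
theorem width_le_of_subset_taylorNewtonSet {lo hi e₁ e₂ μ a b : ℝ}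
    (hY : Y ⊆ Icc lo hi) (hx : x ∈ Icc lo hi) (hμ : 0 < μ) (hdfx : μ ≤ |dfx|)
    (hab : a ≤ b) (hsub : Icc a b ⊆ taylorNewtonSet x fx dfx (Icc e₁ e₂) Y) :
    b - a ≤ max |e₁| |e₂| / μ * (hi - lo) ^ 2 := by
  have h := abs_sub_le_of_mem_taylorNewtonSet hY hx hμ hdfx (hsub (right_mem_Icc.2 hab))
    (hsub (left_mem_Icc.2 hab))
  rwa [abs_of_nonneg (sub_nonneg.2 hab)] at h

end TaylorSet

/-! ### Slope enclosures `M ∌ 0`: sign dichotomy and the modulus `min(|m₁|, |m₂|)` -/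

section Modulus

variable {m₁ m₂ : ℝ}

/-- `0 ∉ [m₁, m₂]` ⇒ `0 < m₁` or `m₂ < 0` (private plumbing) [folklore]. -/
private theorem pos_or_neg' (h0 : (0 : ℝ) ∉ Icc m₁ m₂) : 0 < m₁ ∨ m₂ < 0 := by
  rcases lt_or_ge 0 m₁ with h | h
  · exact Or.inl h
  · exact Or.inr (lt_of_not_ge fun h' => h0 ⟨h, h'⟩)

/-- `t ∈ [m₁, m₂] ∌ 0` ⇒ `0 < min(|m₁|, |m₂|) ≤ |t|` (private plumbing: `|1/M| = 1/min(|m₁|,|m₂|)`)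
[folklore]. -/
private theorem min_abs_pos_le (h0 : (0 : ℝ) ∉ Icc m₁ m₂) {t : ℝ} (ht : t ∈ Icc m₁ m₂) :
    0 < min |m₁| |m₂| ∧ min |m₁| |m₂| ≤ |t| := by
  have hle : m₁ ≤ m₂ := ht.1.trans ht.2
  rcases pos_or_neg' h0 with h | h
  · rw [abs_of_pos h, abs_of_pos (h.trans_le hle), min_eq_left hle, abs_of_pos (h.trans_le ht.1)]
    exact ⟨h, ht.1⟩
  · rw [abs_of_neg (hle.trans_lt h), abs_of_neg h, min_eq_right (neg_le_neg hle),
      abs_of_neg (ht.2.trans_lt h)]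
    exact ⟨neg_pos.2 h, neg_le_neg ht.2⟩

end Modulus

/-! ### Iteration (15) with `p = 1` and Theorem 5 -/

section Run

/-- **A run of the always convergent second-order method — iteration (15) with `p = 1`:**
```
x⁽ᵏ⁾ = m(X⁽ᵏ⁾) ∈ X⁽ᵏ⁾,
X⁽ᵏ⁺¹'⁰⁾ = {x⁽ᵏ⁾ − f(x⁽ᵏ⁾)/M} ∩ X⁽ᵏ⁾,
X⁽ᵏ⁺¹⁾ = X⁽ᵏ⁺¹'¹⁾ = {x⁽ᵏ⁾ − (1/f'(x⁽ᵏ⁾))(f(x⁽ᵏ⁾) + ½F₂(X⁽ᵏ⁺¹'⁰⁾ − x⁽ᵏ⁾)²)} ∩ X⁽ᵏ⁺¹'⁰⁾,  k ≥ 0,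
```
with EXACT arithmetic (`Icc (lo' k) (hi' k)` IS the first intersection and `Icc (lo (k+1)) (hi (k+1))`
IS the second), together with the standing hypotheses: `f` and `f'` differentiable on `X⁽⁰⁾`,
`f'(X⁽⁰⁾) ⊆ M = [m₁, m₂] ∌ 0` (which implies the book's (2)), `f''(X⁽ᵏ⁾) ⊆ F₂⁽ᵏ⁾ = [e₁ k, e₂ k]`
((14) for `i = 2`, allowed to depend on `k`), and the selection `x⁽ᵏ⁾ ∈ X⁽ᵏ⁾` whenever `X⁽ᵏ⁾ ≠ ∅`
[cite: AlefeldHerzberger1983, Ch. 7 §D (15), Thm 5]. -/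
structure IsSecondOrderNewtonRun (f f' f'' : ℝ → ℝ) (m₁ m₂ : ℝ)
    (e₁ e₂ lo hi x lo' hi' : ℕ → ℝ) : Prop where
  hasDerivAt : ∀ t ∈ Icc (lo 0) (hi 0), HasDerivAt f (f' t) t
  hasDerivAt₂ : ∀ t ∈ Icc (lo 0) (hi 0), HasDerivAt f' (f'' t) t
  zero_not_mem : (0 : ℝ) ∉ Icc m₁ m₂
  deriv_mem : ∀ t ∈ Icc (lo 0) (hi 0), f' t ∈ Icc m₁ m₂
  deriv₂_mem : ∀ k, ∀ t ∈ Icc (lo k) (hi k), f'' t ∈ Icc (e₁ k) (e₂ k)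
  center_mem : ∀ k, lo k ≤ hi k → x k ∈ Icc (lo k) (hi k)
  halfStep : ∀ k, Icc (lo' k) (hi' k) = Icc (lo k) (hi k) ∩ newtonSet (x k) (f (x k)) (Icc m₁ m₂)
  step : ∀ k, Icc (lo (k + 1)) (hi (k + 1)) = Icc (lo' k) (hi' k) ∩
    taylorNewtonSet (x k) (f (x k)) (f' (x k)) (Icc (e₁ k) (e₂ k)) (Icc (lo' k) (hi' k))

namespace IsSecondOrderNewtonRun

variable {f f' f'' : ℝ → ℝ} {m₁ m₂ : ℝ} {e₁ e₂ lo hi x lo' hi' : ℕ → ℝ}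
  (h : IsSecondOrderNewtonRun f f' f'' m₁ m₂ e₁ e₂ lo hi x lo' hi')
include h

/-- `X⁽ᵏ⁺¹'⁰⁾ ⊆ X⁽ᵏ⁾` — *"since we take intersections in method (15)"*
[cite: AlefeldHerzberger1983, Ch. 7 §D Thm 5 (17)]. -/
theorem half_subset (k : ℕ) : Icc (lo' k) (hi' k) ⊆ Icc (lo k) (hi k) := by
  rw [h.halfStep k]; exact inter_subset_left

/-- `X⁽ᵏ⁺¹⁾ ⊆ X⁽ᵏ⁺¹'⁰⁾` [cite: AlefeldHerzberger1983, Ch. 7 §D Thm 5 (17)]. -/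
theorem succ_subset_half (k : ℕ) : Icc (lo (k + 1)) (hi (k + 1)) ⊆ Icc (lo' k) (hi' k) := by
  rw [h.step k]; exact inter_subset_left

/-- `X⁽ᵏ⁾ ⊆ X⁽⁰⁾` — (17), nesting `X⁽ᵏ⁾ ⊇ X⁽ᵏ⁺¹'⁰⁾ ⊇ X⁽ᵏ⁺¹⁾`, iterated (no zero needed; the
one-step nesting is `succ_subset_half`/`half_subset`, the general antitone statement is the tree's
`IsKrawczykIteration.subset_of_le` pattern and is not restated) [cite: AlefeldHerzberger1983, Ch. 7 §D Thm 5 (17)]. -/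
theorem subset_zero (k : ℕ) : Icc (lo k) (hi k) ⊆ Icc (lo 0) (hi 0) := by
  induction k with
  | zero => exact Subset.rfl
  | succ n ih => exact ((h.succ_subset_half n).trans (h.half_subset n)).trans ih

/-- **(16), half-step: `ξ ∈ X⁽ᵏ⁾ ⇒ ξ ∈ X⁽ᵏ⁺¹'⁰⁾`** — *"As in Theorem 1 one shows that
ξ ∈ X⁽ᵏ⁺¹'⁰⁾"* (mean value theorem with `f'(X⁽⁰⁾) ⊆ M ∌ 0`)
[cite: AlefeldHerzberger1983, Ch. 7 §D Thm 5 (16)] [cite: Moore1979, §5.2 Thm 5.5]. -/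
theorem zero_mem_half_of_zero_mem {ξ : ℝ} {k : ℕ} (hk : ξ ∈ Icc (lo k) (hi k)) (hfξ : f ξ = 0) :
    ξ ∈ Icc (lo' k) (hi' k) := by
  have hsub := h.subset_zero k
  rw [h.halfStep k]
  exact zero_mem_inter_newtonSet (fun t ht => h.hasDerivAt t (hsub ht))
    (fun t ht => h.deriv_mem t (hsub ht)) h.zero_not_mem (h.center_mem k (hk.1.trans hk.2)) hk hfξ

/-- **(16), Taylor step: `ξ ∈ X⁽ᵏ⁾ ⇒ ξ ∈ X⁽ᵏ⁺¹⁾`** — Taylor's formula at `x⁽ᵏ⁾` with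
`f''(η) ∈ F₂⁽ᵏ⁾` and inclusion monotonicity [cite: AlefeldHerzberger1983, Ch. 7 §D Thm 5 (16)]. -/
theorem zero_mem_succ_of_zero_mem {ξ : ℝ} {k : ℕ} (hk : ξ ∈ Icc (lo k) (hi k)) (hfξ : f ξ = 0) :
    ξ ∈ Icc (lo (k + 1)) (hi (k + 1)) := by
  have hsub := h.subset_zero k
  have hkk : lo k ≤ hi k := hk.1.trans hk.2
  have hxk := h.center_mem k hkk
  have hd0 : f' (x k) ≠ 0 := fun h0 => h.zero_not_mem (h0 ▸ h.deriv_mem (x k) (hsub hxk))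
  have hhalf := h.zero_mem_half_of_zero_mem hk hfξ
  rw [h.step k]
  exact ⟨hhalf, zero_mem_taylorNewtonSet (fun t ht => h.hasDerivAt t (hsub ht))
    (fun t ht => h.hasDerivAt₂ t (hsub ht)) (h.deriv₂_mem k) hxk hd0 (h.half_subset k) hhalf hfξ⟩

/-- **(16): `ξ ∈ X⁽ᵏ⁾` for all `k ≥ 0`** — a zero `ξ ∈ X⁽⁰⁾` of `f` is never lost
[cite: AlefeldHerzberger1983, Ch. 7 §D Thm 5 (16)]. -/
theorem zero_mem {ξ : ℝ} (hξ : ξ ∈ Icc (lo 0) (hi 0)) (hfξ : f ξ = 0) (k : ℕ) :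
    ξ ∈ Icc (lo k) (hi k) := by
  induction k with
  | zero => exact hξ
  | succ n ih => exact h.zero_mem_succ_of_zero_mem ih hfξ

/-- (16) for the intermediate boxes: `ξ ∈ X⁽ᵏ⁺¹'⁰⁾` for all `k`
[cite: AlefeldHerzberger1983, Ch. 7 §D Thm 5 (16)]. -/
theorem zero_mem_half {ξ : ℝ} (hξ : ξ ∈ Icc (lo 0) (hi 0)) (hfξ : f ξ = 0) (k : ℕ) :
    ξ ∈ Icc (lo' k) (hi' k) :=
  h.zero_mem_half_of_zero_mem (h.zero_mem hξ hfξ k) hfξ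

/-- With a zero present no iterate is empty: `x₁⁽ᵏ⁾ ≤ x₂⁽ᵏ⁾`
[cite: AlefeldHerzberger1983, Ch. 7 §D Thm 5 (16)]. -/
theorem lo_le_hi {ξ : ℝ} (hξ : ξ ∈ Icc (lo 0) (hi 0)) (hfξ : f ξ = 0) (k : ℕ) : lo k ≤ hi k :=
  (h.zero_mem hξ hfξ k).1.trans (h.zero_mem hξ hfξ k).2

/-- … nor is any intermediate box: `lo' k ≤ hi' k` [cite: AlefeldHerzberger1983, Ch. 7 §D Thm 5 (16)]. -/
theorem lo'_le_hi' {ξ : ℝ} (hξ : ξ ∈ Icc (lo 0) (hi 0)) (hfξ : f ξ = 0) (k : ℕ) :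
    lo' k ≤ hi' k :=
  (h.zero_mem_half hξ hfξ k).1.trans (h.zero_mem_half hξ hfξ k).2

/-- `m₁ ≤ m₂` (the enclosure `M` contains `f'(ξ)`) [cite: AlefeldHerzberger1983, Ch. 7 §D (2)]. -/
theorem m_le {ξ : ℝ} (hξ : ξ ∈ Icc (lo 0) (hi 0)) : m₁ ≤ m₂ :=
  (h.deriv_mem ξ hξ).1.trans (h.deriv_mem ξ hξ).2

/-- **The book's (2) is implied**: `f(t)/(t − ξ) = (f(t) − f(ξ))/(t − ξ) ∈ M` for `ξ ≠ t ∈ X⁽⁰⁾`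
(mean value theorem) [cite: AlefeldHerzberger1983, Ch. 7 §D (2)]. -/
theorem slope_mem {ξ : ℝ} (hξ : ξ ∈ Icc (lo 0) (hi 0)) (hfξ : f ξ = 0) {t : ℝ}
    (ht : t ∈ Icc (lo 0) (hi 0)) (hne : ξ ≠ t) : f t / (t - ξ) ∈ Icc m₁ m₂ := by
  rcases lt_or_gt_of_ne hne with hlt | hgt
  · have hsub : Icc ξ t ⊆ Icc (lo 0) (hi 0) := Icc_subset_Icc hξ.1 ht.2
    obtain ⟨c, hc, hslope⟩ := exists_hasDerivAt_eq_slope f f' hlt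
      (fun s hs => (h.hasDerivAt s (hsub hs)).continuousAt.continuousWithinAt)
      (fun s hs => h.hasDerivAt s (hsub (Ioo_subset_Icc_self hs)))
    rw [hfξ, sub_zero] at hslope
    rw [← hslope]
    exact h.deriv_mem c (hsub (Ioo_subset_Icc_self hc))
  · have hsub : Icc t ξ ⊆ Icc (lo 0) (hi 0) := Icc_subset_Icc ht.1 hξ.2
    obtain ⟨c, hc, hslope⟩ := exists_hasDerivAt_eq_slope f f' hgt
      (fun s hs => (h.hasDerivAt s (hsub hs)).continuousAt.continuousWithinAt)
      (fun s hs => h.hasDerivAt s (hsub (Ioo_subset_Icc_self hs)))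
    rw [hfξ, zero_sub] at hslope
    have e : f t / (t - ξ) = f' c := by
      rw [hslope, ← neg_sub t ξ, div_neg, neg_div, neg_neg]
    rw [e]
    exact h.deriv_mem c (hsub (Ioo_subset_Icc_self hc))

/-- **(17), quantitative, half-step: `d(X⁽ᵏ⁺¹'⁰⁾) ≤ (1 − m₁/m₂)·d(X⁽ᵏ⁾)`** — *"we show as in
Theorem 1"*; here by the arbitrary-point contraction of `…Contraction.lean`
(`γ(M) = newtonFactor m₁ m₂ = 1 − min|M|/max|M|`) [cite: AlefeldHerzberger1983, Ch. 7 §D Thm 5 (17), Thm 1 (7)]. -/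
theorem width_half_le {ξ : ℝ} (hξ : ξ ∈ Icc (lo 0) (hi 0)) (hfξ : f ξ = 0) (k : ℕ) :
    hi' k - lo' k ≤ newtonFactor m₁ m₂ * (hi k - lo k) := by
  have hk := h.lo'_le_hi' hξ hfξ k
  have hmem : ∀ z ∈ Icc (lo' k) (hi' k),
      z ∈ Icc (lo k) (hi k) ∩ newtonSet (x k) (f (x k)) (Icc m₁ m₂) := by
    intro z hz; rwa [← h.halfStep k]
  have habs := abs_sub_le_newtonFactor_mul_width_of_mem_inter_newtonSet (h.m_le hξ) h.zero_not_mem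
    (h.center_mem k (h.lo_le_hi hξ hfξ k)) (hmem _ (right_mem_Icc.2 hk)) (hmem _ (left_mem_Icc.2 hk))
  rwa [abs_of_nonneg (sub_nonneg.2 hk)] at habs

/-- **(17), quantitative: `d(X⁽ᵏ⁺¹⁾) ≤ (1 − m₁/m₂)·d(X⁽ᵏ⁾)`, `k ≥ 0`** — *"since we take
intersections in method (15)"* [cite: AlefeldHerzberger1983, Ch. 7 §D Thm 5 (17)]. -/
theorem width_succ_le {ξ : ℝ} (hξ : ξ ∈ Icc (lo 0) (hi 0)) (hfξ : f ξ = 0) (k : ℕ) :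
    hi (k + 1) - lo (k + 1) ≤ newtonFactor m₁ m₂ * (hi k - lo k) := by
  have hk1 := h.lo_le_hi hξ hfξ (k + 1)
  obtain ⟨h1, h2⟩ := (Icc_subset_Icc_iff hk1).1 (h.succ_subset_half k)
  linarith [h.width_half_le hξ hfξ k]

/-- **Linear convergence: `d(X⁽ᵏ⁾) ≤ (1 − m₁/m₂)ᵏ·d(X⁽⁰⁾)`** (the geometric consequence of (17), as
in Theorem 1 (6)) [cite: AlefeldHerzberger1983, Ch. 7 §D Thm 5 (17), Thm 1 (6)]. -/
theorem width_le_pow {ξ : ℝ} (hξ : ξ ∈ Icc (lo 0) (hi 0)) (hfξ : f ξ = 0) (k : ℕ) :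
    hi k - lo k ≤ newtonFactor m₁ m₂ ^ k * (hi 0 - lo 0) := by
  induction k with
  | zero => simp
  | succ n ih =>
    calc hi (n + 1) - lo (n + 1) ≤ newtonFactor m₁ m₂ * (hi n - lo n) := h.width_succ_le hξ hfξ n
      _ ≤ newtonFactor m₁ m₂ * (newtonFactor m₁ m₂ ^ n * (hi 0 - lo 0)) :=
          mul_le_mul_of_nonneg_left ih (newtonFactor_nonneg (h.m_le hξ))
      _ = newtonFactor m₁ m₂ ^ (n + 1) * (hi 0 - lo 0) := by ring

/-- **(18): `d(X⁽ᵏ⁺¹⁾) ≤ γ₁·d(X⁽ᵏ⁾)²` with `γ₁ = |F₂/M| = max(|e₁|,|e₂|)/min(|m₁|,|m₂|)`**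
independent of the selection `x⁽ᵏ⁾` — the QUADRATIC convergence of the second-order method
(`F₂ = F₂⁽ᵏ⁾` if the enclosure of `f''` is refreshed) [cite: AlefeldHerzberger1983, Ch. 7 §D Thm 5 (18)]. -/
theorem width_succ_le_sq {ξ : ℝ} (hξ : ξ ∈ Icc (lo 0) (hi 0)) (hfξ : f ξ = 0) (k : ℕ) :
    hi (k + 1) - lo (k + 1) ≤
      max |e₁ k| |e₂ k| / min |m₁| |m₂| * (hi k - lo k) ^ 2 := by
  have hxk := h.center_mem k (h.lo_le_hi hξ hfξ k)
  obtain ⟨hμ, hμle⟩ := min_abs_pos_le h.zero_not_mem (h.deriv_mem (x k) (h.subset_zero k hxk))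
  have hsub : Icc (lo (k + 1)) (hi (k + 1)) ⊆
      taylorNewtonSet (x k) (f (x k)) (f' (x k)) (Icc (e₁ k) (e₂ k)) (Icc (lo' k) (hi' k)) := by
    rw [h.step k]; exact inter_subset_right
  exact width_le_of_subset_taylorNewtonSet (h.half_subset k) hxk hμ hμle
    (h.lo_le_hi hξ hfξ (k + 1)) hsub

/-- **(17), convergence of the widths: `d(X⁽ᵏ⁾) → 0`** (`0 ≤ 1 − m₁/m₂ < 1`)
[cite: AlefeldHerzberger1983, Ch. 7 §D Thm 5 (17)]. -/
theorem tendsto_width {ξ : ℝ} (hξ : ξ ∈ Icc (lo 0) (hi 0)) (hfξ : f ξ = 0) :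
    Tendsto (fun k => hi k - lo k) atTop (𝓝 0) := by
  have hle := h.m_le hξ
  have hpow : Tendsto (fun k => newtonFactor m₁ m₂ ^ k * (hi 0 - lo 0)) atTop (𝓝 0) := by
    simpa using (tendsto_pow_atTop_nhds_zero_of_lt_one (newtonFactor_nonneg hle)
      (newtonFactor_lt_one hle h.zero_not_mem)).mul_const (hi 0 - lo 0)
  exact tendsto_of_tendsto_of_tendsto_of_le_of_le tendsto_const_nhds hpow
    (fun k => sub_nonneg.2 (h.lo_le_hi hξ hfξ k)) (fun k => h.width_le_pow hξ hfξ k)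

/-- **(17): `lim X⁽ᵏ⁾ = ξ`, lower endpoints** [cite: AlefeldHerzberger1983, Ch. 7 §D Thm 5 (17)]. -/
theorem tendsto_lo {ξ : ℝ} (hξ : ξ ∈ Icc (lo 0) (hi 0)) (hfξ : f ξ = 0) :
    Tendsto lo atTop (𝓝 ξ) := by
  have h1 : Tendsto (fun k => ξ - (hi k - lo k)) atTop (𝓝 ξ) := by
    simpa using (tendsto_const_nhds : Tendsto (fun _ : ℕ => ξ) atTop (𝓝 ξ)).sub
      (h.tendsto_width hξ hfξ)
  refine tendsto_of_tendsto_of_tendsto_of_le_of_le h1 tendsto_const_nhds (fun k => ?_) (fun k => ?_)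
  · have hk := h.zero_mem hξ hfξ k
    show ξ - (hi k - lo k) ≤ lo k
    linarith [hk.1, hk.2]
  · exact (h.zero_mem hξ hfξ k).1

/-- **(17): `lim X⁽ᵏ⁾ = ξ`, upper endpoints** [cite: AlefeldHerzberger1983, Ch. 7 §D Thm 5 (17)]. -/
theorem tendsto_hi {ξ : ℝ} (hξ : ξ ∈ Icc (lo 0) (hi 0)) (hfξ : f ξ = 0) :
    Tendsto hi atTop (𝓝 ξ) := by
  have h1 : Tendsto (fun k => ξ + (hi k - lo k)) atTop (𝓝 ξ) := by
    simpa using (tendsto_const_nhds : Tendsto (fun _ : ℕ => ξ) atTop (𝓝 ξ)).add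
      (h.tendsto_width hξ hfξ)
  refine tendsto_of_tendsto_of_tendsto_of_le_of_le tendsto_const_nhds h1 (fun k => ?_) (fun k => ?_)
  · exact (h.zero_mem hξ hfξ k).2
  · have hk := h.zero_mem hξ hfξ k
    show hi k ≤ ξ + (hi k - lo k)
    linarith [hk.1, hk.2]

/-- **(17): `⋂ₖ X⁽ᵏ⁾ = {ξ}`** — the nested iterates shrink to the zero, which is therefore the ONLY
zero of `f` in `X⁽⁰⁾` [cite: AlefeldHerzberger1983, Ch. 7 §D Thm 5 (16)–(17)]. -/
theorem iInter_eq {ξ : ℝ} (hξ : ξ ∈ Icc (lo 0) (hi 0)) (hfξ : f ξ = 0) :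
    (⋂ k, Icc (lo k) (hi k)) = {ξ} := by
  refine Subset.antisymm (fun z hz => ?_) (fun z hz => ?_)
  · rw [mem_iInter] at hz
    have hb : ∀ k, |z - ξ| ≤ hi k - lo k := fun k => by
      have h1 := hz k
      have h2 := h.zero_mem hξ hfξ k
      rw [abs_le]; constructor <;> linarith [h1.1, h1.2, h2.1, h2.2]
    have h0 : |z - ξ| ≤ 0 := ge_of_tendsto' (h.tendsto_width hξ hfξ) hb
    exact mem_singleton_iff.2 (sub_eq_zero.1 (abs_nonpos_iff.1 h0))
  · rw [mem_singleton_iff.1 hz]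
    exact mem_iInter.2 (fun k => h.zero_mem hξ hfξ k)

/-- Every zero of `f` in `X⁽⁰⁾` equals `ξ` (uniqueness from `f'(X⁽⁰⁾) ⊆ M ∌ 0`)
[cite: AlefeldHerzberger1983, Ch. 7 §D Thm 5] [cite: Moore1979, §5.2 Thm 5.5]. -/
theorem eq_of_zero {ξ ζ : ℝ} (hξ : ξ ∈ Icc (lo 0) (hi 0)) (hfξ : f ξ = 0)
    (hζ : ζ ∈ Icc (lo 0) (hi 0)) (hfζ : f ζ = 0) : ζ = ξ :=
  zero_unique_of_deriv_enclosure h.hasDerivAt h.deriv_mem h.zero_not_mem hζ hξ hfζ hfξ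

end IsSecondOrderNewtonRun

/-- **Theorem 5 for `p = 1` (Alefeld–Herzberger, Ch. 7 §D), packaged.**  Along a run of (15) with
`p = 1` and a zero `ξ ∈ X⁽⁰⁾`: (16) `ξ ∈ X⁽ᵏ⁾` (and `ξ ∈ X⁽ᵏ⁺¹'⁰⁾`) for all `k`; (17)
`X⁽⁰⁾ ⊇ X⁽¹⁾ ⊇ ⋯`, `d(X⁽ᵏ⁺¹⁾) ≤ (1 − m₁/m₂)d(X⁽ᵏ⁾)`, `d(X⁽ᵏ⁾) ≤ (1 − m₁/m₂)ᵏ d(X⁽⁰⁾)`,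
`x₁⁽ᵏ⁾ → ξ`, `x₂⁽ᵏ⁾ → ξ`, `⋂ₖ X⁽ᵏ⁾ = {ξ}`; (18) `d(X⁽ᵏ⁺¹⁾) ≤ |F₂⁽ᵏ⁾/M|·d(X⁽ᵏ⁾)²`
[cite: AlefeldHerzberger1983, Ch. 7 §D Thm 5]. -/
theorem alefeldHerzberger_thm5_one {f f' f'' : ℝ → ℝ} {m₁ m₂ : ℝ}
    {e₁ e₂ lo hi x lo' hi' : ℕ → ℝ} (h : IsSecondOrderNewtonRun f f' f'' m₁ m₂ e₁ e₂ lo hi x lo' hi')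
    {ξ : ℝ} (hξ : ξ ∈ Icc (lo 0) (hi 0)) (hfξ : f ξ = 0) :
    (∀ k, ξ ∈ Icc (lo k) (hi k) ∧ ξ ∈ Icc (lo' k) (hi' k)) ∧
      (∀ k, Icc (lo (k + 1)) (hi (k + 1)) ⊆ Icc (lo k) (hi k)) ∧
      (∀ k, hi (k + 1) - lo (k + 1) ≤ newtonFactor m₁ m₂ * (hi k - lo k)) ∧
      (∀ k, hi k - lo k ≤ newtonFactor m₁ m₂ ^ k * (hi 0 - lo 0)) ∧
      Tendsto lo atTop (𝓝 ξ) ∧ Tendsto hi atTop (𝓝 ξ) ∧ (⋂ k, Icc (lo k) (hi k)) = {ξ} ∧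
      (∀ k, hi (k + 1) - lo (k + 1) ≤ max |e₁ k| |e₂ k| / min |m₁| |m₂| * (hi k - lo k) ^ 2) :=
  ⟨fun k => ⟨h.zero_mem hξ hfξ k, h.zero_mem_half hξ hfξ k⟩,
    fun k => (h.succ_subset_half k).trans (h.half_subset k), h.width_succ_le hξ hfξ,
    h.width_le_pow hξ hfξ, h.tendsto_lo hξ hfξ, h.tendsto_hi hξ hfξ, h.iInter_eq hξ hfξ,
    h.width_succ_le_sq hξ hfξ⟩

end Run

/-! ### Krawczyk's second-order method (A–H's report of [34, §9 Thm 3]): zero retention -/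

section Krawczyk

/-- **Krawczyk's second-order method, as reported by Alefeld–Herzberger:**
`X⁽ᵏ⁺¹⁾ = {x⁽ᵏ⁾ − (1/f'(x⁽ᵏ⁾))(f(x⁽ᵏ⁾) + ½f''(X⁽ᵏ⁾)(X⁽ᵏ⁾ − x⁽ᵏ⁾)²)} ∩ X⁽ᵏ⁾`, `x⁽ᵏ⁾ ∈ X⁽ᵏ⁾`,
`f` twice differentiable — *"We have ξ ∈ X⁽ᵏ⁾, k ≥ 0."*  Typed for any boxes with
`X⁽ᵏ⁾ ∩ N₂⁽ᵏ⁾ ⊆ X⁽ᵏ⁺¹⁾ ⊆ X⁽ᵏ⁾` (outer enclosures allowed), `f''(X⁽ᵏ⁾) ⊆ [el k, eh k]` and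
`f'(x⁽ᵏ⁾) ≠ 0` (the book divides by it); no convergence claim (*"Conditions for convergence … are
not given"*) [cite: AlefeldHerzberger1983, Ch. 7 §D (Krawczyk's method [34, §9 Thm 3])]. -/
theorem krawczyk_secondOrder_zero_mem {f f' f'' : ℝ → ℝ} {lo hi x el eh : ℕ → ℝ}
    (hf : ∀ t ∈ Icc (lo 0) (hi 0), HasDerivAt f (f' t) t)
    (hf' : ∀ t ∈ Icc (lo 0) (hi 0), HasDerivAt f' (f'' t) t)
    (hsub : ∀ k, Icc (lo (k + 1)) (hi (k + 1)) ⊆ Icc (lo k) (hi k))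
    (hx : ∀ k, lo k ≤ hi k → x k ∈ Icc (lo k) (hi k))
    (hx0 : ∀ k, lo k ≤ hi k → f' (x k) ≠ 0)
    (hE : ∀ k, ∀ t ∈ Icc (lo k) (hi k), f'' t ∈ Icc (el k) (eh k))
    (hstep : ∀ k, Icc (lo k) (hi k) ∩
      taylorNewtonSet (x k) (f (x k)) (f' (x k)) (Icc (el k) (eh k)) (Icc (lo k) (hi k)) ⊆
        Icc (lo (k + 1)) (hi (k + 1)))
    {ξ : ℝ} (hξ : ξ ∈ Icc (lo 0) (hi 0)) (hfξ : f ξ = 0) (k : ℕ) : ξ ∈ Icc (lo k) (hi k) := by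
  have hsub0 : ∀ k, Icc (lo k) (hi k) ⊆ Icc (lo 0) (hi 0) := by
    intro k
    induction k with
    | zero => exact Subset.rfl
    | succ n ih => exact (hsub n).trans ih
  induction k with
  | zero => exact hξ
  | succ n ih =>
    have hn : lo n ≤ hi n := ih.1.trans ih.2
    exact hstep n ⟨ih, zero_mem_taylorNewtonSet (fun t ht => hf t (hsub0 n ht))
      (fun t ht => hf' t (hsub0 n ht)) (hE n) (hx n hn) (hx0 n hn) Subset.rfl ih hfξ⟩

/-- **Quadratic width bound for Krawczyk's step** (*"the sequence of widths … converges to zero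
quadratically if f'(ξ) ≠ 0"*, one step, given a modulus `|f'(x⁽ᵏ⁾)| ≥ μ > 0`): if
`X⁽ᵏ⁺¹⁾ = [a, b] ≠ ∅` lies inside the second-order set over `X⁽ᵏ⁾ = [lo, hi] ∋ x⁽ᵏ⁾` with
`f''(X⁽ᵏ⁾) ⊆ [el, eh]`, then `b − a ≤ (max(|el|,|eh|)/μ)·(hi − lo)²`
[cite: AlefeldHerzberger1983, Ch. 7 §D (Krawczyk's method [34, §9 Thm 3]), Thm 5 (18)]. -/
theorem krawczyk_secondOrder_width_le {x fx dfx lo hi el eh μ a b : ℝ}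
    (hx : x ∈ Icc lo hi) (hμ : 0 < μ) (hdfx : μ ≤ |dfx|) (hab : a ≤ b)
    (hsub : Icc a b ⊆ taylorNewtonSet x fx dfx (Icc el eh) (Icc lo hi)) :
    b - a ≤ max |el| |eh| / μ * (hi - lo) ^ 2 :=
  width_le_of_subset_taylorNewtonSet Subset.rfl hx hμ hdfx hab hsub

end Krawczyk

/-! ### Worked instance: one second-order step towards `√2` -/

section SqrtTwo

/-- Worked instance (this file's): `f(x) = x² − 2` on `X⁽⁰⁾ = [1, 2]`, `x⁽⁰⁾ = 3/2`, `M = [2, 4]`,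
`F₂ = [2, 2]`.  The half-step is the tree's `sqrtTwo_newtonSet`: `X⁽¹'⁰⁾ = [11/8, 23/16]`.  The
Taylor step over it: `3/2 − (¼ + (y − 3/2)²)/3`, `y ∈ [11/8, 23/16]`, lies in
`[271/192, 1087/768] = [1.41145…, 1.41536…]` [cite: AlefeldHerzberger1983, Ch. 7 §D (15)]. -/
theorem sqrtTwo_taylorNewtonSet_subset :
    taylorNewtonSet (3 / 2 : ℝ) ((3 / 2) ^ 2 - 2) (2 * (3 / 2)) (Icc 2 2) (Icc (11 / 8) (23 / 16)) ⊆
      Icc (271 / 192) (1087 / 768) := by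
  intro z hz
  obtain ⟨e, he, y, hy, rfl⟩ := mem_taylorNewtonSet.1 hz
  have he2 : e = 2 := le_antisymm he.2 he.1
  subst he2
  obtain ⟨hy1, hy2⟩ := hy
  have ha : 0 ≤ 3 / 2 - y - 1 / 16 := by linarith
  have hb : 0 ≤ 3 / 2 - y + 1 / 16 := by linarith
  have hc : 0 ≤ 1 / 8 - (3 / 2 - y) := by linarith
  have hd : 0 ≤ 1 / 8 + (3 / 2 - y) := by linarith
  have hs1 : 1 / 256 ≤ (y - 3 / 2) ^ 2 := by nlinarith [mul_nonneg ha hb]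
  have hs2 : (y - 3 / 2) ^ 2 ≤ 1 / 64 := by nlinarith [mul_nonneg hc hd]
  constructor <;> linarith [hs1, hs2]

/-- **`1.41145 ≤ √2 ≤ 1.41537` in ONE second-order step**: `√2 ∈ [11/8, 23/16] = X⁽¹'⁰⁾` (the
first-order half-step, width `1/16`) and, by (16) with the exact Taylor identity
`x² − 2 = ¼ + 3(x − 3/2) + (x − 3/2)²` (`f'' ≡ 2 ∈ F₂ = [2, 2]`), `√2` lies in the Taylor step
set, hence in `X⁽¹⁾ ⊆ [271/192, 1087/768]`, of width `1/256 = (1/16)²·1` — against `1/16` for the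
half-step alone [cite: AlefeldHerzberger1983, Ch. 7 §D Thm 5 (16), (18)]. -/
theorem sqrt_two_mem_secondOrder_step :
    Real.sqrt 2 ∈ Icc (271 / 192 : ℝ) (1087 / 768) ∧
      ((1087 / 768 : ℝ) - 271 / 192 = 1 / 256) ∧ ((23 / 16 : ℝ) - 11 / 8 = 1 / 16) := by
  refine ⟨?_, by norm_num, by norm_num⟩
  set s := Real.sqrt 2 with hs
  have hs2 : s ^ 2 = 2 := Real.sq_sqrt (by norm_num)
  have hY : s ∈ Icc (11 / 8 : ℝ) (23 / 16) := by
    have h := sqrt_two_mem_endpoint_step_two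
    exact ⟨h.1, h.2.trans (by norm_num)⟩
  have hT : ((3 / 2 : ℝ) ^ 2 - 2) + 2 * (3 / 2) * (s - 3 / 2) + 2 * (s - 3 / 2) ^ 2 / 2 = 0 := by
    have e : ((3 / 2 : ℝ) ^ 2 - 2) + 2 * (3 / 2) * (s - 3 / 2) + 2 * (s - 3 / 2) ^ 2 / 2 = s ^ 2 - 2 := by
      ring
    rw [e, hs2]; norm_num
  have hmem := mem_taylorNewtonSet_of_taylor_eq_zero (E := Icc (2 : ℝ) 2) (by norm_num)
    ⟨le_rfl, le_rfl⟩ hY hT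
  exact sqrtTwo_taylorNewtonSet_subset hmem

end SqrtTwo

end Literature.Analysis.ValidatedNumerics.IntervalNewton
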